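import Summits.BirchSwinnertonDyer.BirchSwinnertonDyer.Theorems.ByReductionTypeAtTwoOrdKatoHalfAtTwoIsoConjATwoCubicModelKernelStamps
import Summits.BirchSwinnertonDyer.BirchSwinnertonDyer.Theorems.ByReductionTypeAtTwoFineSelmerConjAAtTwoAdditivePotGoodTwoLayerStampsEvenIndexB
import Summits.BirchSwinnertonDyer.BirchSwinnertonDyer.Theorems.ByReductionTypeAtTwoFineSelmerConjAAtTwoAdditivePotGoodTwoLayerStampsEvenIndexC
import HarnessLib

/-!
# KERNEL even-index STAMPS at `2`, part B: (A)₂ for `244416cn1`, `434964b1`, `227772e1`, `297264q1` with NO Lim 2017 fact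
# (crux `OrdKatoHalfAtTwoIso`, stmt-BirchSwinnertonDyer-19573; K4 cone; cell bsd-2adic)

Written by the prover seat `cruxlead-stmt-BirchSwinnertonDyer-19573-w2` GEN 7 (`--supports` stmt-BirchSwinnertonDyer-19573; no item closed; BSD is NOT
proved here). Module (E-i): the four remaining `Δ < 0` rows of the cell's EVEN-INDEX stamp files B/C (k4-w1: `conjA_two_244416cn1_of_layerOneBit`,
`conjA_two_434964b1_of_layerOneBit`, `conjA_two_227772e1_of_twoBits`, `conjA_two_297264q1_of_twoBits`, all «granted `hLim2`») re-proved through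
the transfer door `conjA_two_cubicModel_of_evenIndexCertificate_adjoin_eq_of_discr_neg` (E-h): the named fact `hLim2` is GONE; the only remaining
hypotheses of each row are its displayed census bits. The certificate arithmetic is the stamp files' own, verbatim. (The even-index rows `261648q1`,
`279440c1`, `445508b1`, `467928d1` have `Δ > 0` and are outside the scope of the ascent.)

References: [Iwasawa1973MuInvariants] Thm. 2/3; [Fukuda1994] Thm. 1; [CoatesSujatha2005] §3.
-/

set_option autoImplicit false

noncomputable section

open scoped NumberField Polynomial
open NumberField Field Polynomial

namespace Summit.BirchSwinnertonDyer.BirchSwinnertonDyer.Theorems.SteinbergFibreAtTwo.TotallyComplexMu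

open Literature.NumberTheory.EllipticCurves Literature.NumberTheory.EllipticCurves.ZpExtension
  Literature.NumberTheory.GaloisRepresentations Literature.NumberTheory.IwasawaTheory
  Summit.BirchSwinnertonDyer.BirchSwinnertonDyer.Theorems.AddKatoTwo

/-- **(A)₂ for `244416cn1` from ONE parity bit** (a `C1″-RES` row of GEN 4's census: `2 = 𝔭²𝔮` in `ℚ(P)`, `d = -804`). KERNEL — NO Lim 2017 fact (μ₂ ascent `ℚ(θ) → ℚ(E[2])`, `Δ < 0`, w2 GEN 7);
displayed: «`e_1 = 0` along the cyclotomic `ℤ₂`-extensions of `ℚ(θ)`» = `2 ∤ h(ℚ(θ, √2))` (census `cyc6 = []`); `h(ℚ(θ)) = 1` by the kernel certificate `card_classGroup_adjoin_eq_one_disc_neg804`.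
`θ` is any root of `X³ + (-1)X² + (4)X + (-6)`; KERNEL: `ℚ(P) = ℚ(β) = ℚ(θ)` (`β = 37959 + (5892)θ + (17110)θ²` is a root of the
`2`-division cubic), Fukuda's index `0` by the EVEN-INDEX CERTIFICATE `u = [-2, -2, 0]`, `v = [0, -1, -1]`, `m = [-8, 5, 1]`, `m' = [65, -59, 8]`
(coordinates in `1, θ, θ²`; `N(2 − m'³) = 12649572874794`, `8 ∤`), Fukuda Thm. 1 (1).
[cite: Iwasawa1973MuInvariants, Thm. 2 and Thm. 3] [cite: Fukuda1994, Thm. 1 (1), p. 264] -/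
theorem conjA_two_244416cn1_of_layerOneBit_kernel
    {θ : AlgebraicClosure ℚ} (hθ : aeval θ (Cubic.toPoly ⟨1, ((-1 : ℤ) : ℚ), ((4 : ℤ) : ℚ), ((-6 : ℤ) : ℚ)⟩) = 0)
    (h1 : haveI : FiniteDimensional ℚ (IntermediateField.adjoin ℚ {θ}) :=
        IntermediateField.adjoin.finiteDimensional ((AlgebraicClosure.isAlgebraic ℚ).isAlgebraic θ).isIntegral
      haveI : NumberField (IntermediateField.adjoin ℚ {θ}) := NumberField.mk
      ∀ κL : ZpExtension (IntermediateField.adjoin ℚ {θ}) 2, κL.IsCyclotomic → classNumberPExp κL 1 = 0)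
    (κ : ZpExtension ℚ 2) (hκ : κ.IsCyclotomic) :
    haveI := isElliptic_244416cn1'
    ∃ (γ : absoluteGaloisGroup ℚ) (D : (⟨0, ((1 : ℤ) : ℚ), 0, ((-4424231585 : ℤ) : ℚ), ((-113268864408513 : ℤ) : ℚ)⟩ : WeierstrassCurve ℚ).FineSelmerDualData κ γ),
      Module.Finite ℤ_[2] (RestrictScalars ℤ_[2] (IwasawaAlgebra 2) D.X) := by
  haveI := isElliptic_244416cn1'
  have hθ' : θ ^ 3 + (-1 : AlgebraicClosure ℚ) * θ ^ 2 + (4 : AlgebraicClosure ℚ) * θ + (-6 : AlgebraicClosure ℚ) = 0 := by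
    have := hθ
    simp only [Cubic.toPoly, map_one, one_mul, aeval_add, aeval_mul, aeval_C, aeval_X_pow, aeval_X,
      eq_ratCast, Rat.cast_intCast] at this
    push_cast at this
    linear_combination this
  set β : AlgebraicClosure ℚ := algebraMap ℚ (AlgebraicClosure ℚ) (37959 : ℚ) +
      algebraMap ℚ (AlgebraicClosure ℚ) (5892 : ℚ) * θ + algebraMap ℚ (AlgebraicClosure ℚ) (17110 : ℚ) * θ ^ 2 with hβdef
  have hβ : aeval β (Cubic.toPoly ⟨1, ((1 : ℤ) : ℚ), ((-4424231585 : ℤ) : ℚ), ((-113268864408513 : ℤ) : ℚ)⟩) = 0 := by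
    simp only [Cubic.toPoly, map_one, one_mul, aeval_add, aeval_mul, aeval_C, aeval_X_pow, aeval_X, eq_ratCast,
      Rat.cast_intCast]
    rw [hβdef]
    simp only [eq_ratCast]
    push_cast
    linear_combination ((37752041782128 : AlgebraicClosure ℚ) + (25267699503520 : AlgebraicClosure ℚ) * θ + (10183674550600 : AlgebraicClosure ℚ) * θ ^ 2 + (5008988431000 : AlgebraicClosure ℚ) * θ ^ 3) * hθ'
  have hadj : IntermediateField.adjoin ℚ {β} = IntermediateField.adjoin ℚ {θ} := by
    apply le_antisymm
    · rw [IntermediateField.adjoin_simple_le_iff, hβdef]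
      have hθmem := IntermediateField.mem_adjoin_simple_self ℚ θ
      exact add_mem (add_mem (algebraMap_mem _ _) (mul_mem (algebraMap_mem _ _) hθmem))
        (mul_mem (algebraMap_mem _ _) (pow_mem hθmem 2))
    · rw [IntermediateField.adjoin_simple_le_iff]
      have hθeq : θ = algebraMap ℚ (AlgebraicClosure ℚ) (-25232812769127/492640816 : ℚ) +
          algebraMap ℚ (AlgebraicClosure ℚ) (-82130073/123160204 : ℚ) * β +
          algebraMap ℚ (AlgebraicClosure ℚ) (8555/492640816 : ℚ) * β ^ 2 := by
        rw [hβdef]; simp only [eq_ratCast]; push_cast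
        linear_combination (((-1057347397175 : AlgebraicClosure ℚ) / 123160204) + ((-626123553875 : AlgebraicClosure ℚ) / 123160204) * θ) * hθ'
      rw [hθeq]
      have hβmem := IntermediateField.mem_adjoin_simple_self ℚ β
      exact add_mem (add_mem (algebraMap_mem _ _) (mul_mem (algebraMap_mem _ _) hβmem))
        (mul_mem (algebraMap_mem _ _) (pow_mem hβmem 2))
  -- the even-index certificate in `𝓞 ℚ(θ)`
  have hirr := irreducible_cubic_d804n
  haveI : FiniteDimensional ℚ (IntermediateField.adjoin ℚ {θ}) :=
    IntermediateField.adjoin.finiteDimensional ((AlgebraicClosure.isAlgebraic ℚ).isAlgebraic θ).isIntegral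
  haveI : NumberField (IntermediateField.adjoin ℚ {θ}) := NumberField.mk
  obtain ⟨B, -, hB⟩ := exists_ringOfIntegers_cubic_root (p := -1) (q := 4) (r := -6) hθ
  have h3 := finrank_adjoin_eq_three_of_irreducible hirr hθ
  refine conjA_two_cubicModel_of_evenIndexCertificate_adjoin_eq_of_discr_neg 1 (-4424231585) (-113268864408513)
    (by simp only [Cubic.discr]; norm_num) hβ hirr hθ hadj
    (((-2 : ℤ) : 𝓞 (IntermediateField.adjoin ℚ {θ})) + ((-2 : ℤ) : 𝓞 (IntermediateField.adjoin ℚ {θ})) * B + ((0 : ℤ) : 𝓞 (IntermediateField.adjoin ℚ {θ})) * B ^ 2) (((0 : ℤ) : 𝓞 (IntermediateField.adjoin ℚ {θ})) + ((-1 : ℤ) : 𝓞 (IntermediateField.adjoin ℚ {θ})) * B + ((-1 : ℤ) : 𝓞 (IntermediateField.adjoin ℚ {θ})) * B ^ 2) (((-8 : ℤ) : 𝓞 (IntermediateField.adjoin ℚ {θ})) + ((5 : ℤ) : 𝓞 (IntermediateField.adjoin ℚ {θ})) * B + ((1 : ℤ) : 𝓞 (IntermediateField.adjoin ℚ {θ}))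 * B ^ 2) (((65 : ℤ) : 𝓞 (IntermediateField.adjoin ℚ {θ})) + ((-59 : ℤ) : 𝓞 (IntermediateField.adjoin ℚ {θ})) * B + ((8 : ℤ) : 𝓞 (IntermediateField.adjoin ℚ {θ})) * B ^ 2) ?_ ?_ ?_
    (by rw [card_classGroup_adjoin_eq_one_disc_neg804 hθ]; norm_num) h1 κ hκ
  · push_cast; linear_combination (((-6 : ℤ) : 𝓞 (IntermediateField.adjoin ℚ {θ})) + ((-2 : ℤ) : 𝓞 (IntermediateField.adjoin ℚ {θ})) * B) * hB
  · push_cast; linear_combination (((11 : ℤ) : 𝓞 (IntermediateField.adjoin ℚ {θ})) + ((1 : ℤ) : 𝓞 (IntermediateField.adjoin ℚ {θ})) * B) * hB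
  · have hz : (2 : 𝓞 (IntermediateField.adjoin ℚ {θ})) - (((65 : ℤ) : 𝓞 (IntermediateField.adjoin ℚ {θ})) + ((-59 : ℤ) : 𝓞 (IntermediateField.adjoin ℚ {θ})) * B + ((8 : ℤ) : 𝓞 (IntermediateField.adjoin ℚ {θ})) * B ^ 2) ^ 3 =
        ((1285155 : ℤ) : 𝓞 (IntermediateField.adjoin ℚ {θ})) + (-790987 : ℤ) * B + (-122696 : ℤ) * B ^ 2 := by
      push_cast; linear_combination (((259963 : ℤ) : 𝓞 (IntermediateField.adjoin ℚ {θ})) + ((-83160 : ℤ) : 𝓞 (IntermediateField.adjoin ℚ {θ})) * B + ((10816 : ℤ) : 𝓞 (IntermediateField.adjoin ℚ {θ})) * B ^ 2 + ((-512 : ℤ) : 𝓞 (IntermediateField.adjoin ℚ {θ})) * B ^ 3) * hB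
    rw [hz]
    exact not_eight_dvd_norm_coords _ h3 B hirr hB (1285155) (-790987) (-122696) (N := 12649572874794)
      (by simp only [Matrix.one_fin_three, Matrix.det_fin_three, Matrix.add_apply, Matrix.smul_apply, sq, Matrix.mul_apply,
        Fin.sum_univ_three, Matrix.of_apply, Matrix.cons_val', Matrix.cons_val_zero, Matrix.cons_val_one, Matrix.cons_val_two,
        Matrix.head_cons, Matrix.tail_cons, Matrix.empty_val', Matrix.cons_val_fin_one, smul_eq_mul]; norm_num) (by norm_num)

/-- **(A)₂ for `434964b1` from ONE parity bit** (a `C1″-RES` row of GEN 4's census: `2 = 𝔭²𝔮` in `ℚ(P)`, `d = -804`). KERNEL — NO Lim 2017 fact (μ₂ ascent `ℚ(θ) → ℚ(E[2])`, `Δ < 0`, w2 GEN 7);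
displayed: «`e_1 = 0` along the cyclotomic `ℤ₂`-extensions of `ℚ(θ)`» = `2 ∤ h(ℚ(θ, √2))` (census `cyc6 = []`); `h(ℚ(θ)) = 1` by the kernel certificate `card_classGroup_adjoin_eq_one_disc_neg804`.
`θ` is any root of `X³ + (-1)X² + (4)X + (-6)`; KERNEL: `ℚ(P) = ℚ(β) = ℚ(θ)` (`β = 2758 + (428)θ + (1243)θ²` is a root of the
`2`-division cubic), Fukuda's index `0` by the EVEN-INDEX CERTIFICATE `u = [-2, -2, 0]`, `v = [0, -1, -1]`, `m = [-8, 5, 1]`, `m' = [65, -59, 8]`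
(coordinates in `1, θ, θ²`; `N(2 − m'³) = 12649572874794`, `8 ∤`), Fukuda Thm. 1 (1).
[cite: Iwasawa1973MuInvariants, Thm. 2 and Thm. 3] [cite: Fukuda1994, Thm. 1 (1), p. 264] -/
theorem conjA_two_434964b1_of_layerOneBit_kernel
    {θ : AlgebraicClosure ℚ} (hθ : aeval θ (Cubic.toPoly ⟨1, ((-1 : ℤ) : ℚ), ((4 : ℤ) : ℚ), ((-6 : ℤ) : ℚ)⟩) = 0)
    (h1 : haveI : FiniteDimensional ℚ (IntermediateField.adjoin ℚ {θ}) :=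
        IntermediateField.adjoin.finiteDimensional ((AlgebraicClosure.isAlgebraic ℚ).isAlgebraic θ).isIntegral
      haveI : NumberField (IntermediateField.adjoin ℚ {θ}) := NumberField.mk
      ∀ κL : ZpExtension (IntermediateField.adjoin ℚ {θ}) 2, κL.IsCyclotomic → classNumberPExp κL 1 = 0)
    (κ : ZpExtension ℚ 2) (hκ : κ.IsCyclotomic) :
    haveI := isElliptic_434964b1'
    ∃ (γ : absoluteGaloisGroup ℚ) (D : (⟨0, ((-1 : ℤ) : ℚ), 0, ((-23349300 : ℤ) : ℚ), ((-43419126312 : ℤ) : ℚ)⟩ : WeierstrassCurve ℚ).FineSelmerDualData κ γ),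
      Module.Finite ℤ_[2] (RestrictScalars ℤ_[2] (IwasawaAlgebra 2) D.X) := by
  haveI := isElliptic_434964b1'
  have hθ' : θ ^ 3 + (-1 : AlgebraicClosure ℚ) * θ ^ 2 + (4 : AlgebraicClosure ℚ) * θ + (-6 : AlgebraicClosure ℚ) = 0 := by
    have := hθ
    simp only [Cubic.toPoly, map_one, one_mul, aeval_add, aeval_mul, aeval_C, aeval_X_pow, aeval_X,
      eq_ratCast, Rat.cast_intCast] at this
    push_cast at this
    linear_combination this
  set β : AlgebraicClosure ℚ := algebraMap ℚ (AlgebraicClosure ℚ) (2758 : ℚ) +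
      algebraMap ℚ (AlgebraicClosure ℚ) (428 : ℚ) * θ + algebraMap ℚ (AlgebraicClosure ℚ) (1243 : ℚ) * θ ^ 2 with hβdef
  have hβ : aeval β (Cubic.toPoly ⟨1, ((-1 : ℤ) : ℚ), ((-23349300 : ℤ) : ℚ), ((-43419126312 : ℤ) : ℚ)⟩) = 0 := by
    simp only [Cubic.toPoly, map_one, one_mul, aeval_add, aeval_mul, aeval_C, aeval_X_pow, aeval_X, eq_ratCast,
      Rat.cast_intCast]
    rw [hβdef]
    simp only [eq_ratCast]
    push_cast
    linear_combination ((14474199794 : AlgebraicClosure ℚ) + (9687638708 : AlgebraicClosure ℚ) * θ + (3904338823 : AlgebraicClosure ℚ) * θ ^ 2 + (1920495907 : AlgebraicClosure ℚ) * θ ^ 3) * hθ'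
  have hadj : IntermediateField.adjoin ℚ {β} = IntermediateField.adjoin ℚ {θ} := by
    apply le_antisymm
    · rw [IntermediateField.adjoin_simple_le_iff, hβdef]
      have hθmem := IntermediateField.mem_adjoin_simple_self ℚ θ
      exact add_mem (add_mem (algebraMap_mem _ _) (mul_mem (algebraMap_mem _ _) hθmem))
        (mul_mem (algebraMap_mem _ _) (pow_mem hθmem 2))
    · rw [IntermediateField.adjoin_simple_le_iff]
      have hθeq : θ = algebraMap ℚ (AlgebraicClosure ℚ) (-3224561324/131463 : ℚ) +
          algebraMap ℚ (AlgebraicClosure ℚ) (-3468433/788778 : ℚ) * β +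
          algebraMap ℚ (AlgebraicClosure ℚ) (1243/788778 : ℚ) * β ^ 2 := by
        rw [hβdef]; simp only [eq_ratCast]; push_cast
        linear_combination (((-3243057851 : AlgebraicClosure ℚ) / 788778) + ((-1920495907 : AlgebraicClosure ℚ) / 788778) * θ) * hθ'
      rw [hθeq]
      have hβmem := IntermediateField.mem_adjoin_simple_self ℚ β
      exact add_mem (add_mem (algebraMap_mem _ _) (mul_mem (algebraMap_mem _ _) hβmem))
        (mul_mem (algebraMap_mem _ _) (pow_mem hβmem 2))
  -- the even-index certificate in `𝓞 ℚ(θ)`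
  have hirr := irreducible_cubic_d804n
  haveI : FiniteDimensional ℚ (IntermediateField.adjoin ℚ {θ}) :=
    IntermediateField.adjoin.finiteDimensional ((AlgebraicClosure.isAlgebraic ℚ).isAlgebraic θ).isIntegral
  haveI : NumberField (IntermediateField.adjoin ℚ {θ}) := NumberField.mk
  obtain ⟨B, -, hB⟩ := exists_ringOfIntegers_cubic_root (p := -1) (q := 4) (r := -6) hθ
  have h3 := finrank_adjoin_eq_three_of_irreducible hirr hθ
  refine conjA_two_cubicModel_of_evenIndexCertificate_adjoin_eq_of_discr_neg (-1) (-23349300) (-43419126312)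
    (by simp only [Cubic.discr]; norm_num) hβ hirr hθ hadj
    (((-2 : ℤ) : 𝓞 (IntermediateField.adjoin ℚ {θ})) + ((-2 : ℤ) : 𝓞 (IntermediateField.adjoin ℚ {θ})) * B + ((0 : ℤ) : 𝓞 (IntermediateField.adjoin ℚ {θ})) * B ^ 2) (((0 : ℤ) : 𝓞 (IntermediateField.adjoin ℚ {θ})) + ((-1 : ℤ) : 𝓞 (IntermediateField.adjoin ℚ {θ})) * B + ((-1 : ℤ) : 𝓞 (IntermediateField.adjoin ℚ {θ})) * B ^ 2) (((-8 : ℤ) : 𝓞 (IntermediateField.adjoin ℚ {θ})) + ((5 : ℤ) : 𝓞 (IntermediateField.adjoin ℚ {θ})) * B + ((1 : ℤ) : 𝓞 (IntermediateField.adjoin ℚ {θ})) * B ^ 2) (((65 : ℤ) : 𝓞 (IntermediateField.adjoin ℚ {θ})) + ((-59 : ℤ) : 𝓞 (IntermediateField.adjoin ℚ {θ})) * B + ((8 : ℤ) : 𝓞 (IntermediateField.adjoin ℚ {θ})) * B ^ 2) ?_ ?_ ?_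
    (by rw [card_classGroup_adjoin_eq_one_disc_neg804 hθ]; norm_num) h1 κ hκ
  · push_cast; linear_combination (((-6 : ℤ) : 𝓞 (IntermediateField.adjoin ℚ {θ})) + ((-2 : ℤ) : 𝓞 (IntermediateField.adjoin ℚ {θ})) * B) * hB
  · push_cast; linear_combination (((11 : ℤ) : 𝓞 (IntermediateField.adjoin ℚ {θ})) + ((1 : ℤ) : 𝓞 (IntermediateField.adjoin ℚ {θ})) * B) * hB
  · have hz : (2 : 𝓞 (IntermediateField.adjoin ℚ {θ})) - (((65 : ℤ) : 𝓞 (IntermediateField.adjoin ℚ {θ})) + ((-59 : ℤ) : 𝓞 (IntermediateField.adjoin ℚ {θ})) * B + ((8 : ℤ) : 𝓞 (IntermediateField.adjoin ℚ {θ})) * B ^ 2) ^ 3 =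
        ((1285155 : ℤ) : 𝓞 (IntermediateField.adjoin ℚ {θ})) + (-790987 : ℤ) * B + (-122696 : ℤ) * B ^ 2 := by
      push_cast; linear_combination (((259963 : ℤ) : 𝓞 (IntermediateField.adjoin ℚ {θ})) + ((-83160 : ℤ) : 𝓞 (IntermediateField.adjoin ℚ {θ})) * B + ((10816 : ℤ) : 𝓞 (IntermediateField.adjoin ℚ {θ})) * B ^ 2 + ((-512 : ℤ) : 𝓞 (IntermediateField.adjoin ℚ {θ})) * B ^ 3) * hB
    rw [hz]
    exact not_eight_dvd_norm_coords _ h3 B hirr hB (1285155) (-790987) (-122696) (N := 12649572874794)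
      (by simp only [Matrix.one_fin_three, Matrix.det_fin_three, Matrix.add_apply, Matrix.smul_apply, sq, Matrix.mul_apply,
        Fin.sum_univ_three, Matrix.of_apply, Matrix.cons_val', Matrix.cons_val_zero, Matrix.cons_val_one, Matrix.cons_val_two,
        Matrix.head_cons, Matrix.tail_cons, Matrix.empty_val', Matrix.cons_val_fin_one, smul_eq_mul]; norm_num) (by norm_num)

/-- **(A)₂ for `227772e1` from TWO parity bits** (a `C1″-RES` row of GEN 4's census: `2 = 𝔭²𝔮` in `ℚ(P)`, `d = -11988`). KERNEL — NO Lim 2017 fact (μ₂ ascent `ℚ(θ) → ℚ(E[2])`, `Δ < 0`, w2 GEN 7);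
displayed: «`e_1 = 0` along the cyclotomic `ℤ₂`-extensions of `ℚ(θ)`» = `2 ∤ h(ℚ(θ, √2))` (census `cyc6 = []`); `2 ∤ #Cl(𝓞 ℚ(θ))` displayed (census `cyc3 = []`).
`θ` is any root of `X³ + (0)X² + (33)X + (-76)`; KERNEL: `ℚ(P) = ℚ(β) = ℚ(θ)` (`β = 175274/5 + (16286/5)θ + (7967/5)θ²` is a root of the
`2`-division cubic), Fukuda's index `0` by the EVEN-INDEX CERTIFICATE `u = [0, -2, 0]`, `v = [0, -1, -1]`, `m = [-76, -5, 17]`, `m' = [-3572, 14167, -6048]`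
(coordinates in `1, θ, θ²`; `N(2 − m'³) = -385398025154370760808264051881361265030`, `8 ∤`), Fukuda Thm. 1 (1).
[cite: Iwasawa1973MuInvariants, Thm. 2 and Thm. 3] [cite: Fukuda1994, Thm. 1 (1), p. 264] -/
theorem conjA_two_227772e1_of_twoBits_kernel
    {θ : AlgebraicClosure ℚ} (hθ : aeval θ (Cubic.toPoly ⟨1, ((0 : ℤ) : ℚ), ((33 : ℤ) : ℚ), ((-76 : ℤ) : ℚ)⟩) = 0)
    (hh : ¬ 2 ∣ Nat.card (ClassGroup (𝓞 (IntermediateField.adjoin ℚ {θ}))))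
    (h1 : haveI : FiniteDimensional ℚ (IntermediateField.adjoin ℚ {θ}) :=
        IntermediateField.adjoin.finiteDimensional ((AlgebraicClosure.isAlgebraic ℚ).isAlgebraic θ).isIntegral
      haveI : NumberField (IntermediateField.adjoin ℚ {θ}) := NumberField.mk
      ∀ κL : ZpExtension (IntermediateField.adjoin ℚ {θ}) 2, κL.IsCyclotomic → classNumberPExp κL 1 = 0)
    (κ : ZpExtension ℚ 2) (hκ : κ.IsCyclotomic) :
    haveI := isElliptic_227772e1'
    ∃ (γ : absoluteGaloisGroup ℚ) (D : (⟨0, ((0 : ℤ) : ℚ), 0, ((-1754845767 : ℤ) : ℚ), ((-28294794379890 : ℤ) : ℚ)⟩ : WeierstrassCurve ℚ).FineSelmerDualData κ γ),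
      Module.Finite ℤ_[2] (RestrictScalars ℤ_[2] (IwasawaAlgebra 2) D.X) := by
  haveI := isElliptic_227772e1'
  have hθ' : θ ^ 3 + (0 : AlgebraicClosure ℚ) * θ ^ 2 + (33 : AlgebraicClosure ℚ) * θ + (-76 : AlgebraicClosure ℚ) = 0 := by
    have := hθ
    simp only [Cubic.toPoly, map_one, one_mul, aeval_add, aeval_mul, aeval_C, aeval_X_pow, aeval_X,
      eq_ratCast, Rat.cast_intCast] at this
    push_cast at this
    linear_combination this
  set β : AlgebraicClosure ℚ := algebraMap ℚ (AlgebraicClosure ℚ) (175274/5 : ℚ) +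
      algebraMap ℚ (AlgebraicClosure ℚ) (16286/5 : ℚ) * θ + algebraMap ℚ (AlgebraicClosure ℚ) (7967/5 : ℚ) * θ ^ 2 with hβdef
  have hβ : aeval β (Cubic.toPoly ⟨1, ((0 : ℤ) : ℚ), ((-1754845767 : ℤ) : ℚ), ((-28294794379890 : ℤ) : ℚ)⟩) = 0 := by
    simp only [Cubic.toPoly, map_one, one_mul, aeval_add, aeval_mul, aeval_C, aeval_X_pow, aeval_X, eq_ratCast,
      Rat.cast_intCast]
    rw [hβdef]
    simp only [eq_ratCast]
    push_cast
    linear_combination (((76864895212426 : AlgebraicClosure ℚ) / 125) + ((921085050411 : AlgebraicClosure ℚ) / 5) * θ + ((3101168182362 : AlgebraicClosure ℚ) / 125) * θ ^ 2 + ((505690100063 : AlgebraicClosure ℚ) / 125) * θ ^ 3) * hθ'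
  have hadj : IntermediateField.adjoin ℚ {β} = IntermediateField.adjoin ℚ {θ} := by
    apply le_antisymm
    · rw [IntermediateField.adjoin_simple_le_iff, hβdef]
      have hθmem := IntermediateField.mem_adjoin_simple_self ℚ θ
      exact add_mem (add_mem (algebraMap_mem _ _) (mul_mem (algebraMap_mem _ _) hθmem))
        (mul_mem (algebraMap_mem _ _) (pow_mem hθmem 2))
    · rw [IntermediateField.adjoin_simple_le_iff]
      have hθeq : θ = algebraMap ℚ (AlgebraicClosure ℚ) (1553428469521/19 : ℚ) +
          algebraMap ℚ (AlgebraicClosure ℚ) (64229185/38 : ℚ) * β +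
          algebraMap ℚ (AlgebraicClosure ℚ) (-7967/114 : ℚ) * β ^ 2 := by
        rw [hβdef]; simp only [eq_ratCast]; push_cast
        linear_combination (((1033722727454 : AlgebraicClosure ℚ) / 1425) + ((505690100063 : AlgebraicClosure ℚ) / 2850) * θ) * hθ'
      rw [hθeq]
      have hβmem := IntermediateField.mem_adjoin_simple_self ℚ β
      exact add_mem (add_mem (algebraMap_mem _ _) (mul_mem (algebraMap_mem _ _) hβmem))
        (mul_mem (algebraMap_mem _ _) (pow_mem hβmem 2))
  -- the even-index certificate in `𝓞 ℚ(θ)`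
  have hirr := irreducible_cubic_d11988n
  haveI : FiniteDimensional ℚ (IntermediateField.adjoin ℚ {θ}) :=
    IntermediateField.adjoin.finiteDimensional ((AlgebraicClosure.isAlgebraic ℚ).isAlgebraic θ).isIntegral
  haveI : NumberField (IntermediateField.adjoin ℚ {θ}) := NumberField.mk
  obtain ⟨B, -, hB⟩ := exists_ringOfIntegers_cubic_root (p := 0) (q := 33) (r := -76) hθ
  have h3 := finrank_adjoin_eq_three_of_irreducible hirr hθ
  refine conjA_two_cubicModel_of_evenIndexCertificate_adjoin_eq_of_discr_neg 0 (-1754845767) (-28294794379890)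
    (by simp only [Cubic.discr]; norm_num) hβ hirr hθ hadj
    (((0 : ℤ) : 𝓞 (IntermediateField.adjoin ℚ {θ})) + ((-2 : ℤ) : 𝓞 (IntermediateField.adjoin ℚ {θ})) * B + ((0 : ℤ) : 𝓞 (IntermediateField.adjoin ℚ {θ})) * B ^ 2) (((0 : ℤ) : 𝓞 (IntermediateField.adjoin ℚ {θ})) + ((-1 : ℤ) : 𝓞 (IntermediateField.adjoin ℚ {θ})) * B + ((-1 : ℤ) : 𝓞 (IntermediateField.adjoin ℚ {θ})) * B ^ 2) (((-76 : ℤ) : 𝓞 (IntermediateField.adjoin ℚ {θ})) + ((-5 : ℤ) : 𝓞 (IntermediateField.adjoin ℚ {θ})) * B + ((17 : ℤ) : 𝓞 (IntermediateField.adjoin ℚ {θ})) * B ^ 2) (((-3572 : ℤ) : 𝓞 (IntermediateField.adjoin ℚ {θ})) + ((14167 : ℤ) : 𝓞 (IntermediateField.adjoin ℚ {θ})) * B + ((-6048 : ℤ) : 𝓞 (IntermediateField.adjoin ℚ {θ})) * B ^ 2) ?_ ?_ ?_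
    hh h1 κ hκ
  · push_cast; linear_combination (((-4 : ℤ) : 𝓞 (IntermediateField.adjoin ℚ {θ})) + ((-2 : ℤ) : 𝓞 (IntermediateField.adjoin ℚ {θ})) * B) * hB
  · push_cast; linear_combination (((-170 : ℤ) : 𝓞 (IntermediateField.adjoin ℚ {θ})) + ((289 : ℤ) : 𝓞 (IntermediateField.adjoin ℚ {θ})) * B) * hB
  · have hz : (2 : 𝓞 (IntermediateField.adjoin ℚ {θ})) - (((-3572 : ℤ) : 𝓞 (IntermediateField.adjoin ℚ {θ})) + ((14167 : ℤ) : 𝓞 (IntermediateField.adjoin ℚ {θ})) * B + ((-6048 : ℤ) : 𝓞 (IntermediateField.adjoin ℚ {θ})) * B ^ 2) ^ 3 =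
        ((4821159821462574 : ℤ) : 𝓞 (IntermediateField.adjoin ℚ {θ})) + (-2342205213711657 : ℤ) * B + (-7960764352836 : ℤ) * B ^ 2 := by
      push_cast; linear_combination (((63435713758649 : ℤ) : 𝓞 (IntermediateField.adjoin ℚ {θ})) + ((-3266899757856 : ℤ) : 𝓞 (IntermediateField.adjoin ℚ {θ})) * B + ((-1554614498304 : ℤ) : 𝓞 (IntermediateField.adjoin ℚ {θ})) * B ^ 2 + ((221225582592 : ℤ) : 𝓞 (IntermediateField.adjoin ℚ {θ})) * B ^ 3) * hB
    rw [hz]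
    exact not_eight_dvd_norm_coords _ h3 B hirr hB (4821159821462574) (-2342205213711657) (-7960764352836) (N := -385398025154370760808264051881361265030)
      (by simp only [Matrix.one_fin_three, Matrix.det_fin_three, Matrix.add_apply, Matrix.smul_apply, sq, Matrix.mul_apply,
        Fin.sum_univ_three, Matrix.of_apply, Matrix.cons_val', Matrix.cons_val_zero, Matrix.cons_val_one, Matrix.cons_val_two,
        Matrix.head_cons, Matrix.tail_cons, Matrix.empty_val', Matrix.cons_val_fin_one, smul_eq_mul]; norm_num) (by norm_num)

/-- **(A)₂ for `297264q1` from TWO parity bits** (a `C1″-RES` row of GEN 4's census: `2 = 𝔭²𝔮` in `ℚ(P)`, `d = -6756`). KERNEL — NO Lim 2017 fact (μ₂ ascent `ℚ(θ) → ℚ(E[2])`, `Δ < 0`, w2 GEN 7);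
displayed: «`e_1 = 0` along the cyclotomic `ℤ₂`-extensions of `ℚ(θ)`» = `2 ∤ h(ℚ(θ, √2))` (census `cyc6 = []`); `2 ∤ #Cl(𝓞 ℚ(θ))` displayed (census `cyc3 = []`).
`θ` is any root of `X³ + (0)X² + (-51)X + (-148)`; KERNEL: `ℚ(P) = ℚ(β) = ℚ(θ)` (`β = -2005/3 + (3506/3)θ + (59/3)θ²` is a root of the
`2`-division cubic), Fukuda's index `0` by the EVEN-INDEX CERTIFICATE `u = [0, -2, 0]`, `v = [0, -1, -1]`, `m = [-148, -125, -25]`, `m' = [473452, 224125, 27450]`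
(coordinates in `1, θ, θ²`; `N(2 − m'³) = -67030064143170275233513836266567175906966`, `8 ∤`), Fukuda Thm. 1 (1).
[cite: Iwasawa1973MuInvariants, Thm. 2 and Thm. 3] [cite: Fukuda1994, Thm. 1 (1), p. 264] -/
theorem conjA_two_297264q1_of_twoBits_kernel
    {θ : AlgebraicClosure ℚ} (hθ : aeval θ (Cubic.toPoly ⟨1, ((0 : ℤ) : ℚ), ((-51 : ℤ) : ℚ), ((-148 : ℤ) : ℚ)⟩) = 0)
    (hh : ¬ 2 ∣ Nat.card (ClassGroup (𝓞 (IntermediateField.adjoin ℚ {θ}))))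
    (h1 : haveI : FiniteDimensional ℚ (IntermediateField.adjoin ℚ {θ}) :=
        IntermediateField.adjoin.finiteDimensional ((AlgebraicClosure.isAlgebraic ℚ).isAlgebraic θ).isIntegral
      haveI : NumberField (IntermediateField.adjoin ℚ {θ}) := NumberField.mk
      ∀ κL : ZpExtension (IntermediateField.adjoin ℚ {θ}) 2, κL.IsCyclotomic → classNumberPExp κL 1 = 0)
    (κ : ZpExtension ℚ 2) (hκ : κ.IsCyclotomic) :
    haveI := isElliptic_297264q1'
    ∃ (γ : absoluteGaloisGroup ℚ) (D : (⟨0, ((-1 : ℤ) : ℚ), 0, ((-80195004 : ℤ) : ℚ), ((-286282093668 : ℤ) : ℚ)⟩ : WeierstrassCurve ℚ).FineSelmerDualData κ γ),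
      Module.Finite ℤ_[2] (RestrictScalars ℤ_[2] (IwasawaAlgebra 2) D.X) := by
  haveI := isElliptic_297264q1'
  have hθ' : θ ^ 3 + (0 : AlgebraicClosure ℚ) * θ ^ 2 + (-51 : AlgebraicClosure ℚ) * θ + (-148 : AlgebraicClosure ℚ) = 0 := by
    have := hθ
    simp only [Cubic.toPoly, map_one, one_mul, aeval_add, aeval_mul, aeval_C, aeval_X_pow, aeval_X,
      eq_ratCast, Rat.cast_intCast] at this
    push_cast at this
    linear_combination this
  set β : AlgebraicClosure ℚ := algebraMap ℚ (AlgebraicClosure ℚ) (-2005/3 : ℚ) +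
      algebraMap ℚ (AlgebraicClosure ℚ) (3506/3 : ℚ) * θ + algebraMap ℚ (AlgebraicClosure ℚ) (59/3 : ℚ) * θ ^ 2 with hβdef
  have hβ : aeval β (Cubic.toPoly ⟨1, ((-1 : ℤ) : ℚ), ((-80195004 : ℤ) : ℚ), ((-286282093668 : ℤ) : ℚ)⟩) = 0 := by
    simp only [Cubic.toPoly, map_one, one_mul, aeval_add, aeval_mul, aeval_C, aeval_X_pow, aeval_X, eq_ratCast,
      Rat.cast_intCast]
    rw [hβdef]
    simp only [eq_ratCast]
    push_cast
    linear_combination (((42503850622 : AlgebraicClosure ℚ) / 27) + ((721738681 : AlgebraicClosure ℚ) / 9) * θ + ((12204386 : AlgebraicClosure ℚ) / 9) * θ ^ 2 + ((205379 : AlgebraicClosure ℚ) / 27) * θ ^ 3) * hθ'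
  have hadj : IntermediateField.adjoin ℚ {β} = IntermediateField.adjoin ℚ {θ} := by
    apply le_antisymm
    · rw [IntermediateField.adjoin_simple_le_iff, hβdef]
      have hθmem := IntermediateField.mem_adjoin_simple_self ℚ θ
      exact add_mem (add_mem (algebraMap_mem _ _) (mul_mem (algebraMap_mem _ _) hθmem))
        (mul_mem (algebraMap_mem _ _) (pow_mem hθmem 2))
    · rw [IntermediateField.adjoin_simple_le_iff]
      have hθeq : θ = algebraMap ℚ (AlgebraicClosure ℚ) (1576488812/2357947691 : ℚ) +
          algebraMap ℚ (AlgebraicClosure ℚ) (4077659/4715895382 : ℚ) * β +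
          algebraMap ℚ (AlgebraicClosure ℚ) (-59/4715895382 : ℚ) * β ^ 2 := by
        rw [hβdef]; simp only [eq_ratCast]; push_cast
        linear_combination (((12204386 : AlgebraicClosure ℚ) / 21221529219) + ((205379 : AlgebraicClosure ℚ) / 42443058438) * θ) * hθ'
      rw [hθeq]
      have hβmem := IntermediateField.mem_adjoin_simple_self ℚ β
      exact add_mem (add_mem (algebraMap_mem _ _) (mul_mem (algebraMap_mem _ _) hβmem))
        (mul_mem (algebraMap_mem _ _) (pow_mem hβmem 2))
  -- the even-index certificate in `𝓞 ℚ(θ)`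
  have hirr := irreducible_cubic_d6756n
  haveI : FiniteDimensional ℚ (IntermediateField.adjoin ℚ {θ}) :=
    IntermediateField.adjoin.finiteDimensional ((AlgebraicClosure.isAlgebraic ℚ).isAlgebraic θ).isIntegral
  haveI : NumberField (IntermediateField.adjoin ℚ {θ}) := NumberField.mk
  obtain ⟨B, -, hB⟩ := exists_ringOfIntegers_cubic_root (p := 0) (q := -51) (r := -148) hθ
  have h3 := finrank_adjoin_eq_three_of_irreducible hirr hθ
  refine conjA_two_cubicModel_of_evenIndexCertificate_adjoin_eq_of_discr_neg (-1) (-80195004) (-286282093668)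
    (by simp only [Cubic.discr]; norm_num) hβ hirr hθ hadj
    (((0 : ℤ) : 𝓞 (IntermediateField.adjoin ℚ {θ})) + ((-2 : ℤ) : 𝓞 (IntermediateField.adjoin ℚ {θ})) * B + ((0 : ℤ) : 𝓞 (IntermediateField.adjoin ℚ {θ})) * B ^ 2) (((0 : ℤ) : 𝓞 (IntermediateField.adjoin ℚ {θ})) + ((-1 : ℤ) : 𝓞 (IntermediateField.adjoin ℚ {θ})) * B + ((-1 : ℤ) : 𝓞 (IntermediateField.adjoin ℚ {θ})) * B ^ 2) (((-148 : ℤ) : 𝓞 (IntermediateField.adjoin ℚ {θ})) + ((-125 : ℤ) : 𝓞 (IntermediateField.adjoin ℚ {θ})) * B + ((-25 : ℤ) : 𝓞 (IntermediateField.adjoin ℚ {θ})) * B ^ 2) (((473452 : ℤ) : 𝓞 (IntermediateField.adjoin ℚ {θ})) + ((224125 : ℤ) : 𝓞 (IntermediateField.adjoin ℚ {θ})) * B + ((27450 : ℤ) : 𝓞 (IntermediateField.adjoin ℚ {θ})) * B ^ 2) ?_ ?_ ?_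
    hh h1 κ hκ
  · push_cast; linear_combination (((-4 : ℤ) : 𝓞 (IntermediateField.adjoin ℚ {θ})) + ((-2 : ℤ) : 𝓞 (IntermediateField.adjoin ℚ {θ})) * B) * hB
  · push_cast; linear_combination (((6250 : ℤ) : 𝓞 (IntermediateField.adjoin ℚ {θ})) + ((625 : ℤ) : 𝓞 (IntermediateField.adjoin ℚ {θ})) * B) * hB
  · have hz : (2 : 𝓞 (IntermediateField.adjoin ℚ {θ})) - (((473452 : ℤ) : 𝓞 (IntermediateField.adjoin ℚ {θ})) + ((224125 : ℤ) : 𝓞 (IntermediateField.adjoin ℚ {θ})) * B + ((27450 : ℤ) : 𝓞 (IntermediateField.adjoin ℚ {θ})) * B ^ 2) ^ 3 =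
        ((-8636047589761233906 : ℤ) : 𝓞 (IntermediateField.adjoin ℚ {θ})) + (-4016815474903693875 : ℤ) * B + (-484136240522118150 : ℤ) * B ^ 2 := by
      push_cast; linear_combination (((-57634595312415625 : ℤ) : 𝓞 (IntermediateField.adjoin ℚ {θ})) + ((-6261714108483750 : ℤ) : 𝓞 (IntermediateField.adjoin ℚ {θ})) * B + ((-506636243437500 : ℤ) : 𝓞 (IntermediateField.adjoin ℚ {θ})) * B ^ 2 + ((-20683643625000 : ℤ) : 𝓞 (IntermediateField.adjoin ℚ {θ})) * B ^ 3) * hB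
    rw [hz]
    exact not_eight_dvd_norm_coords _ h3 B hirr hB (-8636047589761233906) (-4016815474903693875) (-484136240522118150) (N := -67030064143170275233513836266567175906966)
      (by simp only [Matrix.one_fin_three, Matrix.det_fin_three, Matrix.add_apply, Matrix.smul_apply, sq, Matrix.mul_apply,
        Fin.sum_univ_three, Matrix.of_apply, Matrix.cons_val', Matrix.cons_val_zero, Matrix.cons_val_one, Matrix.cons_val_two,
        Matrix.head_cons, Matrix.tail_cons, Matrix.empty_val', Matrix.cons_val_fin_one, smul_eq_mul]; norm_num) (by norm_num)

end Summit.BirchSwinnertonDyer.BirchSwinnertonDyer.Theorems.SteinbergFibreAtTwo.TotallyComplexMu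

end
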